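import Literature.AlgebraicGeometry.HodgeTheory.WeilClassesTensorBlochSeed
import Literature.AlgebraicGeometry.HodgeTheory.SemiregularVariationalHodgeISemiregular
import Literature.AlgebraicGeometry.HodgeTheory.SemiregularVariationalHodgeProofs
import Literature.AlgebraicGeometry.HodgeTheory.HodgeGenericQbarDescentProofs
import HarnessLib

/-!
# Door II′ of the Weil ladder: Buchweitz–Flenner SHEAF seeds at tensor points feed the local tensor clause
# (the general-`I` form of [BuchweitzFlenner2003, Thm. 5.1], rendered in the tree, in place of Bloch's theorem)

Family `hodge`, layer `Literature/AlgebraicGeometry/HodgeTheory`. Requested by the B2b ladder `hodge-weil` (packet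
`run/shared/lean/b2b/hodge-weil/`, `LADDER.md ## CARVER v8 ADDENDA II` C62/C62a "door II′" and CLAIM TABLE v8.1 row
pv2-g7 (b2)), seat prover 2 generation 7. ONE PREDICATE (real definition) and a PROVED bridge; NOTHING is asserted, no
named fact is introduced. Companion of `WeilClassesTensorBlochSeed.lean` (door T∘S: Bloch seeds = semiregular local
complete intersections); here the seed is a finite locally free SHEAF `ℰ₀` whose partial semiregularity map
`σ_I = (σ_{p−1})_{p ∈ I} : Ext²(ℰ₀, ℰ₀) → ∏_{p∈I} H^{p+1}(Ω^{p−1})` is injective (`IsISemiregular`, BF §5) and whose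
`ch_k` is the seed class — no subscheme, no local-complete-intersection or positivity condition (the three conditions
that killed every lci design of the packet's class test, LADDER C52–C61 and `WeilClassTestCanonicalObstruction.lean`).

* `HasTensorBFSheafSeeds C k p I` (PREDICATE, parametrised by a Chern character theory `C : ChernCharacterBetti` as all
  consumers of the tree's Buchweitz–Flenner facts are): for every tensor point `(Y, Ψ)` (the isogeny-pair clause of
  `HasLocallyAlgebraicTensorAnchors k p` verbatim), every NON-ZERO rational class `x` of its Weil space, every
  hyperplane-type class `h = ι^*a` (as in `HasTensorBlochSeeds`), and EVERY MODEL `e : Y ≅ X₀` of the tensor point (the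
  deformation fact consumes a sheaf on the fibre of the family itself, so the design must be transportable to any
  isomorphic copy — for an honest construction this is automatic), there are a finite locally free `ℰ₀` on `X₀`, `q ∈ ℚ`
  and rationals `c_p` with: `k ∈ I`, `ℰ₀` is `I`-semiregular (`IsISemiregular hℰ₀ {q' | q' + 1 ∈ I}`, BF's `σ_I` in the
  tree's form-degree numbering), `e^* ch_k(ℰ₀) = q·hᵏ + x`, and `e^* ch_p(ℰ₀) = c_p·hᵖ` for the other `p ∈ I` (so that
  every `ch_p`, `p ∈ I`, is the restriction of a GLOBAL class of the family that stays of type `(p,p)`: `hᵖ` is met by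
  `Hᵖ`, `H` the hyperplane class of a projective immersion of the total space). DESIGN INPUT, no on-path lemma; what such
  a seed must look like at class level is recorded in the packet (C62a: all of `ch₁, …, ch₅` pure; definiteness of the
  `E ⊕ F[1]`-type designs open) — this file takes no position on existence.
* `hasLocallyAlgebraicTensorAnchors_of_BF_of_tensorBFSheafSeeds` (PROVED):
  **`BuchweitzFlenner2003_variationalHodge_ISemiregular ∧ HasTensorBFSheafSeeds C k p I ⟹ HasLocallyAlgebraicTensorAnchors k p`.**
  Proof: as in door T∘S, immerse the total space `𝒳` in `ℙᵐ` (`ε`), `H := ε^*a` fibrewise rational `(1,1)`,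
  `B := q·Hᵏ + W` fibrewise rational `(k,k)`; the seed on the model `e₀ : Y ≅ 𝒳_{s₀}` gives `ℰ₀` on `𝒳_{s₀}` with
  `ch_k(ℰ₀) = B|_{s₀}` and `ch_p(ℰ₀) = c_p·Hᵖ|_{s₀}` (`e₀^*` is injective); `Rⁱf_*ℂ` is a local system on all of `S(ℂ)`
  (Ehresmann, `isCohomologicallyLocallyTrivialOn_univ_of_isSmoothProjectiveFamily`; the clause's `S` is smooth and
  irreducible, hence of pure dimension), restrictions of global classes are flat (`transportFun_map_fiberι`), so the
  transports of `ch_p(ℰ₀)`, `p ∈ I`, are the restrictions `B|_t`, `c_p·Hᵖ|_t`, of type `(p,p)`; the fact gives an open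
  `W' ∋ s₀` on which transports along paths in `W'` are algebraic; on the path component `U` of `s₀` in `W'` (open:
  `S(ℂ)` is a manifold) the class `B|_t = q·H|_tᵏ + W|_t` is therefore algebraic — the conclusion of the clause.
* `hasTensorBFSheafSeeds_iff_of_subsingleton`-type sanity is not needed; the on-path status is that of door T∘S: the
  transport input is REFEREED (BF 2003 Thm. 5.1, general `I`, rendered as a named fact for finite locally free sheaves —
  the coherent / perfect-complex versions are NOT rendered, GAPS G44), the seed input is a design input.

Summit-side consumers: the same as for `HasTensorBlochSeeds` (`Summits/…/Theorems/WeilTypeLadderTensorBlochSeed.lean`: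
stmt-2524, R1′, R∞ ⟸ Deligne's fact ∧ TLOCAL), with TLOCAL now fed by `BF ∧ HasTensorBFSheafSeeds C k d I` instead of
`BlochSemiregularSpread ∧ HasTensorBlochSeeds k d`. HONEST FRAMING: not a case of HC, not a rung; 0 unconditional rungs
above the floor. No design passing the packet's class-level requirements for this door is known (LADDER C62a).

## References
* [BuchweitzFlenner2003] R.-O. Buchweitz, H. Flenner, A semiregularity map for modules and applications to
  deformations, Compositio Math. 137 (2003) 135–210, §5 Thm. 5.1 and the definition of `I`-semiregular (p. 25 of
  arXiv:math/9912245).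
* [Deligne1982HodgeCycles] P. Deligne, Hodge cycles on abelian varieties, LNM 900 (1982), proof of Thm. 4.8 (the family
  and its tensor point).
* [VoisinHodgeI2002] C. Voisin, Hodge Theory and Complex Algebraic Geometry I, §9.2.1 and Thm. 9.3 (local systems
  `Rᵏπ_*ℂ`, Ehresmann).
* [VoisinHodgeII2003] C. Voisin, Hodge Theory and Complex Algebraic Geometry II, §1.2.3 Cor. 1.24 (classes restricted
  from projective space are algebraic).
-/

noncomputable section

open CategoryTheory AlgebraicGeometry
open _root_.Topology _root_.Filter

namespace Literature.AlgebraicGeometry.HodgeTheory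

open Literature.AlgebraicTopology.SingularHomology Literature.AlgebraicGeometry.Motives


section HodgeTheory

/-! ### The seed predicate at tensor points (sheaf version) -/

/-- **Buchweitz–Flenner sheaf seeds at tensor points, dimension `2k`, `K = ℚ(√-p)`, Chern degrees `I`** (PREDICATE,
nothing asserted; a DESIGN input with no on-path lemma; parametrised by the Chern character theory `C` like every
consumer of the tree's Buchweitz–Flenner facts). For EVERY complex abelian `2k`-fold `(Y, Ψ)` with `Ψ ≫ Ψ = -p`
carrying an isogeny pair towards a tensor point (the clause of `HasLocallyAlgebraicTensorAnchors k p` VERBATIM), every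
NON-ZERO RATIONAL class `x` of `weilClassesOf Y Ψ k p`, every projective embedding `ι : Y ↪ ℙᴺ` with a non-zero
rational `a ∈ H²(ℙᴺ(ℂ); ℂ)`, and every model `e : Y ≅ X₀`: a finite locally free `ℰ₀` on `X₀`, `q ∈ ℚ` and `c : ℕ → ℚ`
with `k ∈ I`, `ℰ₀` `I`-semiregular ("the part `σ_I : Ext²(ℰ₀, ℰ₀) → ∏_{p ∈ I} H^{p+1}(X₀, Ω^{p−1})` of the
semiregularity map is injective", in the tree's numbering `IsISemiregular hℰ₀ {q' | q' + 1 ∈ I}`),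
`e^*ch_k(ℰ₀) = q·(ι^*a)ᵏ + x` and `e^*ch_p(ℰ₀) = c_p·(ι^*a)ᵖ` for `p ∈ I`, `p ≠ k`.
ERRATUM (2026-08-28; planner seat hodge-idea-3, HSemireg ruling R13.22): as a design input this EXACT-`x` form is
UNSATISFIABLE for any Chern character with the standard integrality (only a discrete subset of the Weil `ℚ`-plane is reachable
by `ch_k − q·hᵏ`), so `hasLocallyAlgebraicTensorAnchors_of_BF_of_tensorBFSheafSeeds` is usable only vacuously; the
declaration is KEPT for its importers and SUPERSEDED by `HasTensorBFSheafSeedsScaled` below (`∃ N ≥ 1, e^*ch_k(ℰ₀) = q·hᵏ + N·x`)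
with the bridge `hasLocallyAlgebraicTensorAnchors_of_BF_of_tensorBFSheafSeedsScaled`; consumers should be fed through the scaled form.
[cite: BuchweitzFlenner2003, §5 Thm. 5.1 (hypotheses: I-semiregular sheaf with prescribed ch_p, p ∈ I)]
[cite: Deligne1982HodgeCycles, proof of Thm. 4.8 (b)–(c) (the tensor point)] -/
def HasTensorBFSheafSeeds (C : ChernCharacterBetti) (k p : ℕ) (I : Finset ℕ) : Prop :=
  ∀ (Y : Motives.AbelianVariety ℂ) (Ψ : Y ⟶ Y), Y.dim = 2 * k → Ψ ≫ Ψ = -((p : ℤ) • 𝟙 Y) →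
    (∃ (A₁ : Motives.AbelianVariety ℂ) (f₁ : Y ⟶ A₁.prod A₁) (g₁ : A₁.prod A₁ ⟶ Y) (m : ℕ),
      A₁.dim = k ∧ 0 < m ∧ f₁ ≫ g₁ = m • 𝟙 Y ∧ AlgebraicGeometry.Flat f₁.hom.hom.hom.left ∧
      g₁ ≫ Ψ = Motives.AbelianVariety.prodLift
        (Motives.AbelianVariety.snd A₁ A₁ ≫ (-((p : ℤ) • 𝟙 A₁))) (Motives.AbelianVariety.fst A₁ A₁) ≫ g₁) →
    ∀ (x : complexBetti Y.X (2 * k)), x ∈ weilClassesOf Y Ψ k p → IsRationalClass x → x ≠ 0 →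
    ∀ (emb : Motives.ProjectiveEmbedding Y.X) (a : complexBetti (Motives.projectiveSpace emb.n ℂ) 2),
      IsRationalClass a → a ≠ 0 →
    ∀ (X₀ : Motives.SchemeOver ℂ) (e : Y.X ≅ X₀),
      ∃ (E₀ : X₀.left.Modules) (hE₀ : Motives.IsFiniteLocallyFree E₀) (q : ℚ) (c : ℕ → ℚ),
        k ∈ I ∧ IsISemiregular hE₀ {q' | q' + 1 ∈ I} ∧
        complexBetti.map e.hom (2 * k) (C.ch X₀ E₀ k) =
          ((q : ℚ) : ℂ) • cupPowTwo (complexBetti.map emb.ι 2 a) k + x ∧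
        ∀ p' ∈ I, p' ≠ k →
          complexBetti.map e.hom (2 * p') (C.ch X₀ E₀ p') =
            ((c p' : ℚ) : ℂ) • cupPowTwo (complexBetti.map emb.ι 2 a) p'

/-! ### The bridge: BF Thm. 5.1 (general `I`) ∧ tensor sheaf seeds ⟹ the local tensor clause -/

/-- **Door II′ fed by Buchweitz–Flenner sheaf seeds: `BuchweitzFlenner2003_variationalHodge_ISemiregular ∧
HasTensorBFSheafSeeds C k p I ⟹ HasLocallyAlgebraicTensorAnchors k p`** (`k ≥ 1`; for `x = 0` the flat section `s ↦ W|_{X_s}` vanishes identically, no seed needed). Given a family `f : 𝒳 ⟶ S` of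
the clause through the tensor point `Y ≅ 𝒳_{s₀}` and a global `W` with `e₀^*(W|_{s₀}) = x`: immerse `𝒳` in some `ℙᵐ`
by a preimmersion `ε`, put `H := ε^*a` (`a ∈ H²(ℙᵐ)` rational non-zero; `H` fibrewise rational `(1,1)`) and
`B := q·Hᵏ + W`; the seed on the model `e₀` is an `I`-semiregular finite locally free `ℰ₀` on `𝒳_{s₀}` with
`ch_k(ℰ₀) = B|_{s₀}`, `ch_p(ℰ₀) = c_p·Hᵖ|_{s₀}` (`p ∈ I ∖ {k}`); `Rⁱf_*ℂ` is a local system on `S(ℂ)` (Ehresmann) and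
restrictions of global classes are flat, so the transports of `ch_p(ℰ₀)` are of type `(p,p)` everywhere; Buchweitz–Flenner's
theorem gives an open `W' ∋ s₀` with the transports along paths inside `W'` algebraic, and on the path component of
`s₀` in `W'` this says `q·H|_tᵏ + W|_t` is algebraic. The clause's hypothesis "fibres abelian with an endomorphism of square
`-p`" is not used. [cite: BuchweitzFlenner2003, §5 Thm. 5.1] [cite: VoisinHodgeI2002, §9.2.1 and Thm. 9.3]
[cite: VoisinHodgeII2003, §1.2.3 Cor. 1.24] [cite: Hartshorne1977, II §4] -/
theorem hasLocallyAlgebraicTensorAnchors_of_BF_of_tensorBFSheafSeeds {k p : ℕ} (hk : 0 < k)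
    (C : ChernCharacterBetti) {I : Finset ℕ}
    (hBF : BuchweitzFlenner2003_variationalHodge_ISemiregular)
    (hT : HasTensorBFSheafSeeds C k p I) :
    HasLocallyAlgebraicTensorAnchors k p := by
  intro Y Ψ hY hΨ hpt x hxW hxr 𝒳 S f hf h𝒳 hS hSirr hsm _ W hW s₀ e₀ he₀
  -- (1) an immersion of the total space in some `ℙᵐ`; the induced projective embedding of `Y`
  obtain ⟨P, j, ⟨m, κ, hκ⟩, hj⟩ := id h𝒳
  haveI := hκ
  haveI := hj
  set ε : 𝒳 ⟶ Motives.projectiveSpace m ℂ := j ≫ κ with hεdef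
  haveI : IsPreimmersion ε.left := by
    rw [hεdef, Over.comp_left]
    infer_instance
  haveI : IsProper f.left := hf.isProper
  haveI : IsSeparated S.hom := hS.isSeparated
  haveI hcl : IsClosedImmersion (Motives.fiberι f s₀ ≫ ε).left :=
    isClosedImmersion_fiberι_comp_left_of_isPreimmersion f ε s₀
  haveI : IsIso e₀.hom.left := (inferInstance : IsIso ((Over.forget _).mapIso e₀).hom)
  have hcl' : IsClosedImmersion (e₀.hom ≫ Motives.fiberι f s₀ ≫ ε).left := by
    rw [Over.comp_left]
    infer_instance
  let emb : Motives.ProjectiveEmbedding Y.X := ⟨m, e₀.hom ≫ Motives.fiberι f s₀ ≫ ε, hcl'⟩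
  -- (2) `m ≥ 1`: the `2k`-fold `Y` is closed in `ℙᵐ`
  have hYsp : Motives.IsSmoothProjective Y.dim Y.X := Motives.AbelianVariety.isSmoothProjective_holds (A := Y)
  have hm : 1 ≤ m := by
    obtain ⟨Bm⟩ := (nonempty_hodgeModel_holds (n := Y.dim) (X := Y.X)).nonempty hYsp
    obtain ⟨Am⟩ := (nonempty_hodgeModel_holds (n := m) (X := Motives.projectiveSpace m ℂ)).nonempty
      (Motives.isSmoothProjective_projectiveSpace_holds ℂ m)
    have hle : Y.dim ≤ m := dim_le_of_isClosedImmersion_projectiveSpace hYsp emb.ι Bm Am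
    rw [hY] at hle
    omega
  -- (3) a non-zero rational `a ∈ H²(ℙᵐ)` and the global class `H := ε^* a`
  obtain ⟨a, ha, ha0⟩ := exists_isRationalClass_ne_zero_projectiveSpace hm
  set H : complexBetti 𝒳 2 := complexBetti.map ε 2 a with hHdef
  have hHs : ∀ s : Motives.ComplexPoints S, complexBetti.map (Motives.fiberι f s) 2 H =
      complexBetti.map (Motives.fiberι f s ≫ ε) 2 a := by
    intro s
    rw [hHdef, complexBetti.map_comp (Motives.fiberι f s) ε 2, CategoryTheory.comp_apply]
  have hH : ∀ s : Motives.ComplexPoints S,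
      IsRationalClass (complexBetti.map (Motives.fiberι f s) 2 H) ∧
        IsOfHodgeType (2 * k) (Motives.fiberOver f s) 2 1 1 (complexBetti.map (Motives.fiberι f s) 2 H) := by
    intro s
    rw [hHs]
    refine ⟨ha.map _, ?_⟩
    have halg : complexBetti.map (Motives.fiberι f s ≫ ε) (2 * 1) a ∈ algebraicClasses (Motives.fiberOver f s) 1 :=
      map_projectiveSpace_mem_algebraicClasses (hf.isSmoothProjective s) _ 1 a
    exact isOfHodgeType_of_mem_algebraicClasses_of_isSmoothProjective (hf.isSmoothProjective s) 1 halg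
  have hH₀ : complexBetti.map e₀.hom 2 (complexBetti.map (Motives.fiberι f s₀) 2 H) =
      complexBetti.map emb.ι 2 a := by
    rw [hHs, ← CategoryTheory.comp_apply, ← complexBetti.map_comp]
  have hHp₀ : ∀ p' : ℕ, complexBetti.map e₀.hom (2 * p')
      (complexBetti.map (Motives.fiberι f s₀) (2 * p') (cupPowTwo H p')) =
        cupPowTwo (complexBetti.map emb.ι 2 a) p' := by
    intro p'
    rw [complexBetti_map_cupPowTwo', complexBetti_map_cupPowTwo', hH₀]
  -- (4) `Rⁱf_*ℂ` is a local system on all of `S(ℂ)`, which is a path connected, locally path connected manifold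
  haveI := hsm
  haveI : LocallyOfFiniteType S.hom := hS.locallyOfFiniteType
  haveI : ConnectedSpace (Motives.ComplexPoints S) :=
    (Motives.ComplexPoints.connectedSpace_iff_holds S).2 inferInstance
  obtain ⟨d, hd⟩ := exists_smoothOfRelativeDimension_of_connectedSpace_complexPoints S
  haveI := hd
  haveI := pathConnectedSpace_complexPoints_of_smoothOfRelativeDimension S d
  have hU : IsCohomologicallyLocallyTrivialOn f (Set.univ : Set (Motives.ComplexPoints S)) :=
    isCohomologicallyLocallyTrivialOn_univ_of_isSmoothProjectiveFamily f d hf hS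
  letI := Motives.ComplexPoints.chartedSpace S d
  haveI : LocallyPathConnectedSpace (Motives.ComplexPoints S) :=
    ChartedSpace.locallyPathConnectedSpace (EuclideanSpace ℝ (Fin (2 * d))) (Motives.ComplexPoints S)
  let s₀' : (Set.univ : Set (Motives.ComplexPoints S)) := ⟨s₀, Set.mem_univ s₀⟩
  -- a path in `univ` from `s₀` to any point, as a homotopy class
  have hpath : ∀ t : Motives.ComplexPoints S,
      Nonempty (Path.Homotopic.Quotient s₀' (⟨t, Set.mem_univ t⟩ : (Set.univ : Set (Motives.ComplexPoints S)))) := by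
    intro t
    obtain ⟨γ⟩ := (PathConnectedSpace.joined (X := Motives.ComplexPoints S) s₀ t)
    exact ⟨⟦{ toFun := fun u ↦ ⟨γ u, Set.mem_univ _⟩
              continuous_toFun := γ.continuous.subtype_mk _
              source' := Subtype.ext γ.source
              target' := Subtype.ext γ.target }⟧⟩
  by_cases hx0 : x = 0
  · -- (5a) `x = 0`: the flat section `s ↦ W|_{X_s}` vanishes at `s₀`, hence everywhere; take `q = 0`
    have hW₀ : complexBetti.map (Motives.fiberι f s₀) (2 * k) W = 0 := by
      apply complexBetti.map_injective_of_iso e₀ (2 * k)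
      rw [he₀, hx0, map_zero]
    refine ⟨Set.univ, H, 0, isOpen_univ, Set.mem_univ _, hH, fun s _ => ?_⟩
    obtain ⟨γ⟩ := hpath s
    have hWs : complexBetti.map (Motives.fiberι f s) (2 * k) W = 0 := by
      have h := transportFun_map_fiberι f (2 * k) hU γ W
      rw [hW₀, transportFun_zero] at h
      exact h.symm
    rw [hWs, Rat.cast_zero, zero_smul, zero_add]
    exact Submodule.zero_mem _
  · -- (5b) `x ≠ 0`: the sheaf seed on the model `e₀ : Y ≅ 𝒳_{s₀}`
    obtain ⟨E₀, hE₀, q, c, hkI, hsr, hchk, hchp⟩ :=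
      hT Y Ψ hY hΨ hpt x hxW hxr hx0 emb a ha ha0 (Motives.fiberOver f s₀) e₀
    -- the global class `B := q·Hᵏ + W` and its restrictions
    set Bcl : complexBetti 𝒳 (2 * k) := ((q : ℚ) : ℂ) • cupPowTwo H k + W with hBdef
    have hres : ∀ s : Motives.ComplexPoints S, complexBetti.map (Motives.fiberι f s) (2 * k) Bcl =
        ((q : ℚ) : ℂ) • cupPowTwo (complexBetti.map (Motives.fiberι f s) 2 H) k +
          complexBetti.map (Motives.fiberι f s) (2 * k) W := by
      intro s
      rw [hBdef, map_add, map_smul, complexBetti_map_cupPowTwo']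
    have hBrat : ∀ s : Motives.ComplexPoints S,
        IsOfHodgeType (2 * k) (Motives.fiberOver f s) (2 * k) k k
          (complexBetti.map (Motives.fiberι f s) (2 * k) Bcl) := by
      intro s
      rw [hres]
      exact ((isOfHodgeType_cupPowTwo (hf.isSmoothProjective s) (hH s).2 k).smul _).add
        (hf.isSmoothProjective s) (hW s).2
    -- `ch_k(ℰ₀) = B|_{s₀}` and `ch_p(ℰ₀) = c_p·Hᵖ|_{s₀}` (pull back by the iso `e₀` and compare on `Y`)
    have hchk' : C.ch (Motives.fiberOver f s₀) E₀ k = complexBetti.map (Motives.fiberι f s₀) (2 * k) Bcl := by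
      apply complexBetti.map_injective_of_iso e₀ (2 * k)
      rw [hchk, hres, map_add, map_smul, complexBetti_map_cupPowTwo', hH₀, he₀]
    have hchp' : ∀ p' ∈ I, p' ≠ k → C.ch (Motives.fiberOver f s₀) E₀ p' =
        complexBetti.map (Motives.fiberι f s₀) (2 * p') (((c p' : ℚ) : ℂ) • cupPowTwo H p') := by
      intro p' hp' hp'k
      apply complexBetti.map_injective_of_iso e₀ (2 * p')
      rw [hchp p' hp' hp'k, map_smul, map_smul, hHp₀ p']
    -- (6) Buchweitz–Flenner's hypotheses over `U = S(ℂ)`: the transports of `ch_p(ℰ₀)`, `p ∈ I`, are of type `(p,p)`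
    have hHodge : ∀ p' ∈ I, ∀ (t : (Set.univ : Set (Motives.ComplexPoints S)))
        (γ : Path.Homotopic.Quotient s₀' t),
        IsOfHodgeType (2 * k) (Motives.fiberOver f t.1) (2 * p') p' p'
          (transportFun f (2 * p') hU γ (C.ch (Motives.fiberOver f s₀'.1) E₀ p')) := by
      intro p' hp' t γ
      by_cases hp'k : p' = k
      · subst hp'k
        change IsOfHodgeType (2 * p') (Motives.fiberOver f t.1) (2 * p') p' p'
          (transportFun f (2 * p') hU γ (C.ch (Motives.fiberOver f s₀) E₀ p'))
        rw [hchk', transportFun_map_fiberι f (2 * p') hU γ Bcl]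
        exact hBrat t.1
      · change IsOfHodgeType (2 * k) (Motives.fiberOver f t.1) (2 * p') p' p'
          (transportFun f (2 * p') hU γ (C.ch (Motives.fiberOver f s₀) E₀ p'))
        rw [hchp' p' hp' hp'k, transportFun_map_fiberι f (2 * p') hU γ, map_smul, complexBetti_map_cupPowTwo']
        exact (isOfHodgeType_cupPowTwo (hf.isSmoothProjective t.1) (hH t.1).2 p').smul _
    obtain ⟨W', hWo, hW'₀, hWU, hW'⟩ := hBF C f (2 * k) hf hsm hU s₀' E₀ hE₀ I hsr hHodge
    -- (7) conclude on the path component of `s₀` in `W'`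
    refine ⟨pathComponentIn W' s₀, H, q, hWo.pathComponentIn s₀, mem_pathComponentIn_self hW'₀, hH,
      fun t ht ↦ ?_⟩
    have hj : JoinedIn W' s₀ t := ht
    have hpm : ∀ u, hj.somePath u ∈ W' := hj.somePath_mem
    let γ : Path (⟨s₀, hW'₀⟩ : W') ⟨t, pathComponentIn_subset ht⟩ :=
      { toFun := fun u ↦ ⟨hj.somePath u, hpm u⟩
        continuous_toFun := hj.somePath.continuous.subtype_mk _
        source' := Subtype.ext hj.somePath.source
        target' := Subtype.ext hj.somePath.target }
    have hmem := hW' k hkI ⟨t, pathComponentIn_subset ht⟩ ⟦γ⟧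
    have htr : transportFun f (2 * k) (hU.mono hWU hWo) ⟦γ⟧ (C.ch (Motives.fiberOver f s₀) E₀ k) =
        complexBetti.map (Motives.fiberι f t) (2 * k) Bcl := by
      rw [hchk']
      exact transportFun_map_fiberι f (2 * k) (hU.mono hWU hWo) ⟦γ⟧ Bcl
    change transportFun f (2 * k) (hU.mono hWU hWo) ⟦γ⟧ (C.ch (Motives.fiberOver f s₀) E₀ k) ∈ _ at hmem
    rw [htr, hres] at hmem
    exact hmem

/-! ### ERRATUM (2026-08-28) and the SCALED seed predicate with its bridge -/

/-- **Buchweitz–Flenner sheaf seeds at tensor points — SCALED form** (PREDICATE, nothing asserted; the satisfiable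
restatement of `HasTensorBFSheafSeeds`, all binders verbatim except the last clause). ERRATUM to `HasTensorBFSheafSeeds`
(finding of the planner seat hodge-idea-3, REPAIR-TensorMonadSeeds-2026-08-28.md; HSemireg cell ruling R13.22): that
predicate asks the seed to hit `q·hᵏ + x` EXACTLY for EVERY non-zero rational Weil class `x`; for a Chern character with the
standard integrality (`ch_k(ℰ₀) ∈ (1∕k!)·H^{2k}(X₀(ℂ); ℤ)`), modulo the line `ℚ·hᵏ` the reachable classes form a lattice, which
meets the Weil `ℚ`-plane in a discrete set — so almost every rational `x` has no seed, the predicate is unsatisfiable by honest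
instances and its bridge usable only vacuously. HERE the seed is asked for SOME POSITIVE INTEGER MULTIPLE of `x`: a finite locally
free `ℰ₀`, `q ∈ ℚ`, `c : ℕ → ℚ` and `N ≥ 1` with `k ∈ I`, `ℰ₀` `I`-semiregular, `e^*ch_k(ℰ₀) = q·(ι^*a)ᵏ + N·x` and
`e^*ch_p(ℰ₀) = c_p·(ι^*a)ᵖ` (`p ∈ I`, `p ≠ k`) — what class-level certificates (identities with rational weights) witness. The
bridge to the local tensor clause survives with the same proof (`hasLocallyAlgebraicTensorAnchors_of_BF_of_tensorBFSheafSeedsScaled`: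
algebraic classes form a `ℂ`-subspace, so `N` divides out); exact seeds are scaled seeds with `N = 1`
(`hasTensorBFSheafSeedsScaled_of_exact`). DESIGN INPUT; this file takes no position on existence.
[cite: BuchweitzFlenner2003, §5 Thm. 5.1 (hypotheses: I-semiregular sheaf with prescribed ch_p, p ∈ I)]
[cite: Deligne1982HodgeCycles, proof of Thm. 4.8 (b)–(c) (the tensor point)] -/
def HasTensorBFSheafSeedsScaled (C : ChernCharacterBetti) (k p : ℕ) (I : Finset ℕ) : Prop :=
  ∀ (Y : Motives.AbelianVariety ℂ) (Ψ : Y ⟶ Y), Y.dim = 2 * k → Ψ ≫ Ψ = -((p : ℤ) • 𝟙 Y) →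
    (∃ (A₁ : Motives.AbelianVariety ℂ) (f₁ : Y ⟶ A₁.prod A₁) (g₁ : A₁.prod A₁ ⟶ Y) (m : ℕ),
      A₁.dim = k ∧ 0 < m ∧ f₁ ≫ g₁ = m • 𝟙 Y ∧ AlgebraicGeometry.Flat f₁.hom.hom.hom.left ∧
      g₁ ≫ Ψ = Motives.AbelianVariety.prodLift
        (Motives.AbelianVariety.snd A₁ A₁ ≫ (-((p : ℤ) • 𝟙 A₁))) (Motives.AbelianVariety.fst A₁ A₁) ≫ g₁) →
    ∀ (x : complexBetti Y.X (2 * k)), x ∈ weilClassesOf Y Ψ k p → IsRationalClass x → x ≠ 0 →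
    ∀ (emb : Motives.ProjectiveEmbedding Y.X) (a : complexBetti (Motives.projectiveSpace emb.n ℂ) 2),
      IsRationalClass a → a ≠ 0 →
    ∀ (X₀ : Motives.SchemeOver ℂ) (e : Y.X ≅ X₀),
      ∃ (E₀ : X₀.left.Modules) (hE₀ : Motives.IsFiniteLocallyFree E₀) (q : ℚ) (c : ℕ → ℚ) (N : ℕ),
        0 < N ∧ k ∈ I ∧ IsISemiregular hE₀ {q' | q' + 1 ∈ I} ∧
        complexBetti.map e.hom (2 * k) (C.ch X₀ E₀ k) =
          ((q : ℚ) : ℂ) • cupPowTwo (complexBetti.map emb.ι 2 a) k + (N : ℂ) • x ∧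
        ∀ p' ∈ I, p' ≠ k →
          complexBetti.map e.hom (2 * p') (C.ch X₀ E₀ p') =
            ((c p' : ℚ) : ℂ) • cupPowTwo (complexBetti.map emb.ι 2 a) p'

/-- exact seeds are scaled seeds (`N = 1`): the old predicate implies the new one (consistency of the restatement; private —
uncited plumbing between the two predicates). [folklore] -/
private theorem hasTensorBFSheafSeedsScaled_of_exact {C : ChernCharacterBetti} {k p : ℕ} {I : Finset ℕ}
    (h : HasTensorBFSheafSeeds C k p I) : HasTensorBFSheafSeedsScaled C k p I := by
  intro Y Ψ hY hΨ hpt x hxW hxr hx0 emb a ha ha0 X₀ e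
  obtain ⟨E₀, hE₀, q, c, hkI, hsr, hchk, hchp⟩ := h Y Ψ hY hΨ hpt x hxW hxr hx0 emb a ha ha0 X₀ e
  exact ⟨E₀, hE₀, q, c, 1, Nat.one_pos, hkI, hsr, by rw [hchk, Nat.cast_one, one_smul], hchp⟩

/-- **Door II′ fed by SCALED Buchweitz–Flenner sheaf seeds: `BuchweitzFlenner2003_variationalHodge_ISemiregular ∧
HasTensorBFSheafSeedsScaled C k p I ⟹ HasLocallyAlgebraicTensorAnchors k p`** (`k ≥ 1`). The proof of
`hasLocallyAlgebraicTensorAnchors_of_BF_of_tensorBFSheafSeeds` verbatim with the global class `B := q·Hᵏ + N·W` (`N ≥ 1` from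
the seed): Buchweitz–Flenner's theorem makes `q·H|ₜᵏ + N·W|ₜ` algebraic on the path component of `s₀` in `W'`, and the
algebraic classes of the fibre form a `ℂ`-subspace, so `(q∕N)·H|ₜᵏ + W|ₜ` is algebraic: the clause holds with `q∕N`.
[cite: BuchweitzFlenner2003, §5 Thm. 5.1] [cite: VoisinHodgeI2002, §9.2.1 and Thm. 9.3]
[cite: VoisinHodgeII2003, §1.2.3 Cor. 1.24] [cite: Hartshorne1977, II §4] -/
theorem hasLocallyAlgebraicTensorAnchors_of_BF_of_tensorBFSheafSeedsScaled {k p : ℕ} (hk : 0 < k)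
    (C : ChernCharacterBetti) {I : Finset ℕ}
    (hBF : BuchweitzFlenner2003_variationalHodge_ISemiregular)
    (hT : HasTensorBFSheafSeedsScaled C k p I) :
    HasLocallyAlgebraicTensorAnchors k p := by
  intro Y Ψ hY hΨ hpt x hxW hxr 𝒳 S f hf h𝒳 hS hSirr hsm _ W hW s₀ e₀ he₀
  -- (1) an immersion of the total space in some `ℙᵐ`; the induced projective embedding of `Y`
  obtain ⟨P, j, ⟨m, κ, hκ⟩, hj⟩ := id h𝒳
  haveI := hκ
  haveI := hj
  set ε : 𝒳 ⟶ Motives.projectiveSpace m ℂ := j ≫ κ with hεdef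
  haveI : IsPreimmersion ε.left := by
    rw [hεdef, Over.comp_left]
    infer_instance
  haveI : IsProper f.left := hf.isProper
  haveI : IsSeparated S.hom := hS.isSeparated
  haveI hcl : IsClosedImmersion (Motives.fiberι f s₀ ≫ ε).left :=
    isClosedImmersion_fiberι_comp_left_of_isPreimmersion f ε s₀
  haveI : IsIso e₀.hom.left := (inferInstance : IsIso ((Over.forget _).mapIso e₀).hom)
  have hcl' : IsClosedImmersion (e₀.hom ≫ Motives.fiberι f s₀ ≫ ε).left := by
    rw [Over.comp_left]
    infer_instance
  let emb : Motives.ProjectiveEmbedding Y.X := ⟨m, e₀.hom ≫ Motives.fiberι f s₀ ≫ ε, hcl'⟩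
  -- (2) `m ≥ 1`: the `2k`-fold `Y` is closed in `ℙᵐ`
  have hYsp : Motives.IsSmoothProjective Y.dim Y.X := Motives.AbelianVariety.isSmoothProjective_holds (A := Y)
  have hm : 1 ≤ m := by
    obtain ⟨Bm⟩ := (nonempty_hodgeModel_holds (n := Y.dim) (X := Y.X)).nonempty hYsp
    obtain ⟨Am⟩ := (nonempty_hodgeModel_holds (n := m) (X := Motives.projectiveSpace m ℂ)).nonempty
      (Motives.isSmoothProjective_projectiveSpace_holds ℂ m)
    have hle : Y.dim ≤ m := dim_le_of_isClosedImmersion_projectiveSpace hYsp emb.ι Bm Am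
    rw [hY] at hle
    omega
  -- (3) a non-zero rational `a ∈ H²(ℙᵐ)` and the global class `H := ε^* a`
  obtain ⟨a, ha, ha0⟩ := exists_isRationalClass_ne_zero_projectiveSpace hm
  set H : complexBetti 𝒳 2 := complexBetti.map ε 2 a with hHdef
  have hHs : ∀ s : Motives.ComplexPoints S, complexBetti.map (Motives.fiberι f s) 2 H =
      complexBetti.map (Motives.fiberι f s ≫ ε) 2 a := by
    intro s
    rw [hHdef, complexBetti.map_comp (Motives.fiberι f s) ε 2, CategoryTheory.comp_apply]
  have hH : ∀ s : Motives.ComplexPoints S,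
      IsRationalClass (complexBetti.map (Motives.fiberι f s) 2 H) ∧
        IsOfHodgeType (2 * k) (Motives.fiberOver f s) 2 1 1 (complexBetti.map (Motives.fiberι f s) 2 H) := by
    intro s
    rw [hHs]
    refine ⟨ha.map _, ?_⟩
    have halg : complexBetti.map (Motives.fiberι f s ≫ ε) (2 * 1) a ∈ algebraicClasses (Motives.fiberOver f s) 1 :=
      map_projectiveSpace_mem_algebraicClasses (hf.isSmoothProjective s) _ 1 a
    exact isOfHodgeType_of_mem_algebraicClasses_of_isSmoothProjective (hf.isSmoothProjective s) 1 halg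
  have hH₀ : complexBetti.map e₀.hom 2 (complexBetti.map (Motives.fiberι f s₀) 2 H) =
      complexBetti.map emb.ι 2 a := by
    rw [hHs, ← CategoryTheory.comp_apply, ← complexBetti.map_comp]
  have hHp₀ : ∀ p' : ℕ, complexBetti.map e₀.hom (2 * p')
      (complexBetti.map (Motives.fiberι f s₀) (2 * p') (cupPowTwo H p')) =
        cupPowTwo (complexBetti.map emb.ι 2 a) p' := by
    intro p'
    rw [complexBetti_map_cupPowTwo', complexBetti_map_cupPowTwo', hH₀]
  -- (4) `Rⁱf_*ℂ` is a local system on all of `S(ℂ)`, which is a path connected, locally path connected manifold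
  haveI := hsm
  haveI : LocallyOfFiniteType S.hom := hS.locallyOfFiniteType
  haveI : ConnectedSpace (Motives.ComplexPoints S) :=
    (Motives.ComplexPoints.connectedSpace_iff_holds S).2 inferInstance
  obtain ⟨d, hd⟩ := exists_smoothOfRelativeDimension_of_connectedSpace_complexPoints S
  haveI := hd
  haveI := pathConnectedSpace_complexPoints_of_smoothOfRelativeDimension S d
  have hU : IsCohomologicallyLocallyTrivialOn f (Set.univ : Set (Motives.ComplexPoints S)) :=
    isCohomologicallyLocallyTrivialOn_univ_of_isSmoothProjectiveFamily f d hf hS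
  letI := Motives.ComplexPoints.chartedSpace S d
  haveI : LocallyPathConnectedSpace (Motives.ComplexPoints S) :=
    ChartedSpace.locallyPathConnectedSpace (EuclideanSpace ℝ (Fin (2 * d))) (Motives.ComplexPoints S)
  let s₀' : (Set.univ : Set (Motives.ComplexPoints S)) := ⟨s₀, Set.mem_univ s₀⟩
  -- a path in `univ` from `s₀` to any point, as a homotopy class
  have hpath : ∀ t : Motives.ComplexPoints S,
      Nonempty (Path.Homotopic.Quotient s₀' (⟨t, Set.mem_univ t⟩ : (Set.univ : Set (Motives.ComplexPoints S)))) := by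
    intro t
    obtain ⟨γ⟩ := (PathConnectedSpace.joined (X := Motives.ComplexPoints S) s₀ t)
    exact ⟨⟦{ toFun := fun u ↦ ⟨γ u, Set.mem_univ _⟩
              continuous_toFun := γ.continuous.subtype_mk _
              source' := Subtype.ext γ.source
              target' := Subtype.ext γ.target }⟧⟩
  by_cases hx0 : x = 0
  · -- (5a) `x = 0`: the flat section `s ↦ W|_{X_s}` vanishes at `s₀`, hence everywhere; take `q = 0`
    have hW₀ : complexBetti.map (Motives.fiberι f s₀) (2 * k) W = 0 := by
      apply complexBetti.map_injective_of_iso e₀ (2 * k)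
      rw [he₀, hx0, map_zero]
    refine ⟨Set.univ, H, 0, isOpen_univ, Set.mem_univ _, hH, fun s _ => ?_⟩
    obtain ⟨γ⟩ := hpath s
    have hWs : complexBetti.map (Motives.fiberι f s) (2 * k) W = 0 := by
      have h := transportFun_map_fiberι f (2 * k) hU γ W
      rw [hW₀, transportFun_zero] at h
      exact h.symm
    rw [hWs, Rat.cast_zero, zero_smul, zero_add]
    exact Submodule.zero_mem _
  · -- (5b) `x ≠ 0`: the sheaf seed on the model `e₀ : Y ≅ 𝒳_{s₀}`
    obtain ⟨E₀, hE₀, q, c, N, hN, hkI, hsr, hchk, hchp⟩ :=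
      hT Y Ψ hY hΨ hpt x hxW hxr hx0 emb a ha ha0 (Motives.fiberOver f s₀) e₀
    -- the global class `B := q·Hᵏ + N·W` and its restrictions
    set Bcl : complexBetti 𝒳 (2 * k) := ((q : ℚ) : ℂ) • cupPowTwo H k + (N : ℂ) • W with hBdef
    have hres : ∀ s : Motives.ComplexPoints S, complexBetti.map (Motives.fiberι f s) (2 * k) Bcl =
        ((q : ℚ) : ℂ) • cupPowTwo (complexBetti.map (Motives.fiberι f s) 2 H) k +
          (N : ℂ) • complexBetti.map (Motives.fiberι f s) (2 * k) W := by
      intro s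
      rw [hBdef, map_add, map_smul, map_smul, complexBetti_map_cupPowTwo']
    have hBrat : ∀ s : Motives.ComplexPoints S,
        IsOfHodgeType (2 * k) (Motives.fiberOver f s) (2 * k) k k
          (complexBetti.map (Motives.fiberι f s) (2 * k) Bcl) := by
      intro s
      rw [hres]
      exact ((isOfHodgeType_cupPowTwo (hf.isSmoothProjective s) (hH s).2 k).smul _).add
        (hf.isSmoothProjective s) ((hW s).2.smul _)
    -- `ch_k(ℰ₀) = B|_{s₀}` and `ch_p(ℰ₀) = c_p·Hᵖ|_{s₀}` (pull back by the iso `e₀` and compare on `Y`)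
    have hchk' : C.ch (Motives.fiberOver f s₀) E₀ k = complexBetti.map (Motives.fiberι f s₀) (2 * k) Bcl := by
      apply complexBetti.map_injective_of_iso e₀ (2 * k)
      rw [hchk, hres, map_add, map_smul, map_smul, complexBetti_map_cupPowTwo', hH₀, he₀]
    have hchp' : ∀ p' ∈ I, p' ≠ k → C.ch (Motives.fiberOver f s₀) E₀ p' =
        complexBetti.map (Motives.fiberι f s₀) (2 * p') (((c p' : ℚ) : ℂ) • cupPowTwo H p') := by
      intro p' hp' hp'k
      apply complexBetti.map_injective_of_iso e₀ (2 * p')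
      rw [hchp p' hp' hp'k, map_smul, map_smul, hHp₀ p']
    -- (6) Buchweitz–Flenner's hypotheses over `U = S(ℂ)`: the transports of `ch_p(ℰ₀)`, `p ∈ I`, are of type `(p,p)`
    have hHodge : ∀ p' ∈ I, ∀ (t : (Set.univ : Set (Motives.ComplexPoints S)))
        (γ : Path.Homotopic.Quotient s₀' t),
        IsOfHodgeType (2 * k) (Motives.fiberOver f t.1) (2 * p') p' p'
          (transportFun f (2 * p') hU γ (C.ch (Motives.fiberOver f s₀'.1) E₀ p')) := by
      intro p' hp' t γ
      by_cases hp'k : p' = k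
      · subst hp'k
        change IsOfHodgeType (2 * p') (Motives.fiberOver f t.1) (2 * p') p' p'
          (transportFun f (2 * p') hU γ (C.ch (Motives.fiberOver f s₀) E₀ p'))
        rw [hchk', transportFun_map_fiberι f (2 * p') hU γ Bcl]
        exact hBrat t.1
      · change IsOfHodgeType (2 * k) (Motives.fiberOver f t.1) (2 * p') p' p'
          (transportFun f (2 * p') hU γ (C.ch (Motives.fiberOver f s₀) E₀ p'))
        rw [hchp' p' hp' hp'k, transportFun_map_fiberι f (2 * p') hU γ, map_smul, complexBetti_map_cupPowTwo']
        exact (isOfHodgeType_cupPowTwo (hf.isSmoothProjective t.1) (hH t.1).2 p').smul _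
    obtain ⟨W', hWo, hW'₀, hWU, hW'⟩ := hBF C f (2 * k) hf hsm hU s₀' E₀ hE₀ I hsr hHodge
    -- (7) conclude on the path component of `s₀` in `W'`
    refine ⟨pathComponentIn W' s₀, H, q / N, hWo.pathComponentIn s₀, mem_pathComponentIn_self hW'₀, hH,
      fun t ht ↦ ?_⟩
    have hj : JoinedIn W' s₀ t := ht
    have hpm : ∀ u, hj.somePath u ∈ W' := hj.somePath_mem
    let γ : Path (⟨s₀, hW'₀⟩ : W') ⟨t, pathComponentIn_subset ht⟩ :=
      { toFun := fun u ↦ ⟨hj.somePath u, hpm u⟩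
        continuous_toFun := hj.somePath.continuous.subtype_mk _
        source' := Subtype.ext hj.somePath.source
        target' := Subtype.ext hj.somePath.target }
    have hmem := hW' k hkI ⟨t, pathComponentIn_subset ht⟩ ⟦γ⟧
    have htr : transportFun f (2 * k) (hU.mono hWU hWo) ⟦γ⟧ (C.ch (Motives.fiberOver f s₀) E₀ k) =
        complexBetti.map (Motives.fiberι f t) (2 * k) Bcl := by
      rw [hchk']
      exact transportFun_map_fiberι f (2 * k) (hU.mono hWU hWo) ⟦γ⟧ Bcl
    change transportFun f (2 * k) (hU.mono hWU hWo) ⟦γ⟧ (C.ch (Motives.fiberOver f s₀) E₀ k) ∈ _ at hmem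
    rw [htr, hres] at hmem
    -- divide `N` out inside the `ℂ`-subspace of algebraic classes
    have hN0 : (N : ℂ) ≠ 0 := Nat.cast_ne_zero.2 hN.ne'
    have h2 := Submodule.smul_mem (algebraicClasses (Motives.fiberOver f t) k) ((N : ℂ)⁻¹) hmem
    rw [smul_add, smul_smul, smul_smul, inv_mul_cancel₀ hN0, one_smul] at h2
    have hq : (((q / N : ℚ)) : ℂ) = (N : ℂ)⁻¹ * ((q : ℚ) : ℂ) := by
      push_cast
      ring
    rw [hq]
    exact h2

end HodgeTheory

end Literature.AlgebraicGeometry.HodgeTheory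

end
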